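import Literature.NumberTheory.EllipticCurves.PastenSpectralDegreeProofs
import Literature.NumberTheory.EllipticCurves.ModularSymbolsPeriodHomology
import Literature.NumberTheory.EllipticCurves.ModularDegreeFormulaProofs
import Literature.NumberTheory.EllipticCurves.ModularCurveManinSemistableBridgeProofs
import Mathlib.Algebra.Module.ZLattice.Covolume
import Mathlib.MeasureTheory.Measure.Haar.InnerProductSpace
import HarnessLib

/-!
# Pasten's Thm. 5.5 for `X₀(N)` from Riemann's period relations: Lemma 5.6 in homological form
# (proofs; companion of `PastenSpectralDegree.lean` and `PastenSpectralDegreeProofs.lean`)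

Topic `NumberTheory/EllipticCurves`; a proofs-only file (theorems only: no definition, no named
fact, nothing restated; D-0026) written by the seat of the named fact `PastenShimura2024_thm_5_5`
(H. Pasten, *Shimura curves and the abc conjecture*, J. Number Theory 254 (2024) =
arXiv:1705.09251, Thm. 5.5 p. 18, case `D = 1`, `M = N`: *"The `(D,M)`-modular degree `δ`
divides `∏_{[χ] ≠ [χ₀]} η_{[χ₀]}([χ])`"*).

`PastenSpectralDegreeProofs.lean` proved everything in Pasten's **second proof** (§5.6, p. 19)
except its **Lemma 5.6** — *"`δ` is the denominator of the projector `π₀` with respect to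
`𝔼 = End(J₀^D(M))`: `m π₀ ∈ 𝔼 ⇒ δ ∣ m`"* ([CoKa], [ARSdeg] for `X₀(N)`) — for which it fell back on
Ribet's theorem `m_E ∣ r_E` (the tree's unproved named fact `modularDegree_dvd_congruenceNumber`).
This file proves **Lemma 5.6 itself, in homological form, from Riemann's period relations for
`X₀(N)`**, and hence Thm. 5.5 from those relations alone, bypassing Ribet's theorem and the
congruence number. The Jacobian enters only through its period lattice: `J₀(N)(ℂ) = S₂^∨/H` with
`H = periodHomology N ⊆ S₂(Γ₀(N))^∨` the period homology (`ModularSymbolsPeriodHomology.lean`: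
the image of `H₁(X₀(N), ℤ)`, a full lattice by the tree's Eichler–Shimura theorem
`periodHomology_eq_span_basis_holds`), on which `𝕋` acts by transposition
(`dualMap_heckeT_mem_periodHomology`), and `E = ℂ/Λ_f`, `Λ_f = ev_f(H)`.

## The argument (Pasten §5.6 with Lemma 5.6 unfolded on `H₁`)

Let `D` be a datum of minimal degree with newform `f`, `d = deg φ_D`, and let `t ∈ End S₂(Γ₀(N))`
preserve `H` under transposition and act as `t = R · π₀` (`t g = μ_g f`, `μ_g ⟨f,f⟩ = R ⟨f,g⟩`;
Pasten's `ϖ`, `R = ∏ η`, by `exists_varpi` and `exists_apply_eq_smul_of_forall_mem_minimalPrimes`).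

1. `anemicHeckeRing.dualMap_mem_periodHomology` — every `t ∈ 𝕋 = ℤ[T_p : p ∤ N]` satisfies
   `t^∨ H ⊆ H` (adjoin induction on the tree's `dualMap_heckeT_mem_periodHomology`; Cremona 1997,
   §2.4).
2. `exists_int_mul_im_conj_mul_eq_of_periodRelations` — for `λ = φ(f) ∈ Λ_f` (`φ ∈ H`) the class
   `ψ = t^∨ φ ∈ H` is `g ↦ R λ ⟨f,g⟩/⟨f,f⟩`, i.e. the Petersson pairing with
   `h = (R λ̄/⟨f,f⟩) f`; Riemann's period relations (hypothesis `hRB`, below) applied to `ψ`, `h`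
   and any `φ' ∈ H` with `φ'(f) = ν` give `R · Im(λ̄ ν) ∈ 4π² ⟨f,f⟩ ℤ` for all `λ, ν ∈ Λ_f`.
3. `ModularParametrizationData.modularDegree_dvd_of_periodRelations` (**Lemma 5.6, homological
   form**) — `d ∣ R`: minimality makes `D` optimal, `Λ_E = c Λ_f` (`exists_optimalDatum'`,
   `latticeEq_of_modularDegree_le`, both proved in the tree), Zagier's formula
   `4π² c² ⟨f,f⟩ = d · covol(Λ_E)` (`zagier_degree_formula_holds`, proved in the tree) turns step 2
   at the basis `ω₁/c, ω₂/c` of `Λ_f` into `R · Im(ω̄₁ ω₂) ∈ d · covol(Λ_E) ℤ`, and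
   `covol(Λ_E) = |Im(ω̄₁ ω₂)| ≠ 0`.
4. `ModularParametrizationData.modularDegree_dvd_prod_heckeCongruenceModulus_of_periodRelations`,
   `PastenShimura2024_thm_5_5_of_periodRelations` — Thm. 5.5 with `t = ϖ`.

## The hypothesis `hRB` (Riemann's period relations for `X₀(N)`, Petersson form)

For `ψ ∈ H` with Petersson–Riesz representative `h ∈ S₂(Γ₀(N))` (`ψ(g) = ⟨h, g⟩` for all `g`,
`⟨·,·⟩ = peterssonProduct`, antilinear in the first slot) and every `φ ∈ H`:
`Im φ(h) ∈ 4π² ℤ`. This is the statement that the intersection pairing of `H₁(X₀(N), ℤ)` is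
integral, written through the period isomorphism: with `η_c` the closed dual form of a cycle `c`
(`∫_c α = -∬ α ∧ η_c`, Farkas–Kra II.3.3, III.1.1 (1.1.1)) one has `η_c = ω_u + ω̄_u` up to an
exact form with `ω_u = 2πi u dτ`, `∬ ω_g ∧ ω̄_u = -8π² i ⟨u, g⟩`, so the Riesz representative of
`ψ = ∫_c` is `h = ±8π² i u`, and `a · c = ∫_a η_c ∈ ℤ` (Farkas–Kra III.1.1 (1.1.6)) reads
`Im φ_a(h) = ±4π² (a · c)`. Sanity check at `N = 11` (`g = 1`, `H = {φ : φ(f) ∈ Λ_f}`): `hRB` says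
`Im(λ̄ν) ∈ 4π²⟨f,f⟩ℤ` on `Λ_f`, i.e. (with unimodularity) `4π²⟨f,f⟩ = covol(Λ_f)`, which is Zagier's
formula with `deg(X₀(11) → E_f) = 1`. The relations are **not** proved here (no Stokes theorem on
`Γ₀(N)∖ℍ` in the tree); they are the exact remaining input for `PastenShimura2024_thm_5_5` (and,
with the Hecke duality `S₂(ℤ) ≅ Hom(𝕋, ℤ)` of Agashe–Ribet–Stein §4, for Ribet's theorem).
`hRB` is a hypothesis of the theorems below — the trust base of this reduction — not a named fact.

## References

* H. Pasten, *Shimura curves and the abc conjecture*, J. Number Theory 254 (2024), 214–335 =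
  arXiv:1705.09251: Thm. 5.5 (p. 18), §5.6 with Lemma 5.6 (p. 19). [PastenShimura2024]
* H. M. Farkas, I. Kra, *Riemann Surfaces*, 2nd ed., GTM 71, Springer 1992: II.3.3, III.1.1
  ((1.1.1)–(1.1.6)), III.2 (2.3.1), III.3.2. [FarkasKra1992]
* D. Zagier, *Modular parametrizations of elliptic curves*, Canad. Math. Bull. 28 (1985): §1
  (p. 374). [ZagierCMB1985]
* J. E. Cremona, *Algorithms for modular elliptic curves*, 2nd ed., CUP 1997: §2.1, §2.4.
  [CremonaAlgorithms1997]
* A. Agashe, K. A. Ribet, W. A. Stein, *The modular degree, congruence primes, and multiplicity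
  one* (2012): Thm. 2.1, §4. [AgasheRibetStein2012]
-/

noncomputable section

open scoped MatrixGroups ModularForm ComplexConjugate

open CongruenceSubgroup UpperHalfPlane Complex MeasureTheory

namespace Literature.NumberTheory.EllipticCurves.ModularForms

section HeckeOnHomology

variable {N : ℕ} [NeZero N]

/-- **The Hecke ring acts on the period homology by transposition**: for `t ∈ 𝕋 = ℤ[T_p : p ∤ N]`
and `φ ∈ H = periodHomology N ⊆ S₂(Γ₀(N))^∨`, `t^∨ φ = φ ∘ t ∈ H` (Cremona 1997, §2.4:
"`⟨T_p{α,β}, f⟩ = ⟨{α,β}, T_p f⟩`", the tree's `dualMap_heckeT_mem_periodHomology`, extended to the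
ring generated by the `T_p` by induction). [cite: CremonaAlgorithms1997, §2.4] -/
theorem anemicHeckeRing.dualMap_mem_periodHomology (t : anemicHeckeRing N 2)
    {φ : Module.Dual ℂ (CuspForm (Gamma0 N) 2)} (hφ : φ ∈ periodHomology N) :
    (t : Module.End ℂ (CuspForm (Gamma0 N) 2)).dualMap φ ∈ periodHomology N := by
  obtain ⟨t, ht⟩ := t
  change t.dualMap φ ∈ periodHomology N
  induction ht using Algebra.adjoin_induction generalizing φ with
  | mem x hx =>
    obtain ⟨p, hp, hpN, rfl⟩ := hx
    haveI : NeZero p := ⟨hp.ne_zero⟩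
    exact dualMap_heckeT_mem_periodHomology N hp hφ
  | algebraMap r =>
    have h : (algebraMap ℤ (Module.End ℂ (CuspForm (Gamma0 N) 2)) r).dualMap φ = r • φ := by
      ext g
      rw [LinearMap.dualMap_apply, Algebra.algebraMap_eq_smul_one, LinearMap.smul_apply,
        Module.End.one_apply, LinearMap.smul_apply, map_zsmul]
    rw [h]
    exact (periodHomology N).zsmul_mem hφ r
  | add x y _ _ hx hy =>
    have h : (x + y).dualMap φ = x.dualMap φ + y.dualMap φ := by
      ext g
      simp only [LinearMap.dualMap_apply, LinearMap.add_apply, map_add]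
    rw [h]
    exact add_mem (hx hφ) (hy hφ)
  | mul x y _ _ hx hy =>
    have h : (x * y).dualMap φ = y.dualMap (x.dualMap φ) := by
      ext g
      simp only [LinearMap.dualMap_apply, Module.End.mul_apply]
    rw [h]
    exact hy (hx hφ)

end HeckeOnHomology

/-! ### From the period relations to `R · Im(λ̄ ν) ∈ 4π² ⟨f,f⟩ ℤ` -/

section PeriodRelations

variable {N : ℕ} [NeZero N]

/-- **From the period relations to `R · Im(λ̄ ν) ∈ 4π² ⟨f, f⟩ ℤ` on `Λ_f`.** Let `f ≠ 0`, let
`t ∈ End S₂(Γ₀(N))` preserve the period homology `H` under transposition and act as `R · π₀`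
(`t g = μ_g f` with `μ_g ⟨f,f⟩ = R ⟨f,g⟩`, `π₀` the Petersson projection onto `ℂf`; Pasten 2024,
§5.6: "`ϖ = (∏ η) π₀`"), and assume Riemann's period relations `hRB` for `X₀(N)` (module
docstring; Farkas–Kra III.1.1). Then for all periods `λ, ν ∈ Λ_f` there is `n ∈ ℤ` with
`R · Im(λ̄ ν) = 4π² ⟨f,f⟩ n`: for `φ ∈ H` with `φ(f) = λ`, `t^∨ φ ∈ H` is the Petersson pairing with
`h = (R λ̄ / ⟨f,f⟩) f`, and `hRB` at `φ'` with `φ'(f) = ν` gives `Im φ'(h) = R Im(λ̄ν)/⟨f,f⟩ ∈ 4π²ℤ`.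
[cite: PastenShimura2024, §5.6 p. 19 (Lemma 5.6)] [cite: FarkasKra1992, III.1.1 (1.1.6)] -/
theorem exists_int_mul_im_conj_mul_eq_of_periodRelations
    (hRB : ∀ ψ ∈ periodHomology N, ∀ h : CuspForm (Gamma0 N) 2,
      (∀ g, ψ g = peterssonProduct (Gamma0 N) 2 h g) →
      ∀ φ ∈ periodHomology N, ∃ n : ℤ, (φ h).im = 4 * Real.pi ^ 2 * n)
    {f : CuspForm (Gamma0 N) 2} (hf0 : f ≠ 0)
    {t : Module.End ℂ (CuspForm (Gamma0 N) 2)}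
    (ht : ∀ φ ∈ periodHomology N, t.dualMap φ ∈ periodHomology N) {R : ℤ}
    (hproj : ∀ g, ∃ μ : ℂ, t g = μ • f ∧
      μ * peterssonProduct (Gamma0 N) 2 f f = (R : ℂ) * peterssonProduct (Gamma0 N) 2 f g)
    {lam nu : ℂ} (hlam : lam ∈ periodLattice f) (hnu : nu ∈ periodLattice f) :
    ∃ n : ℤ, (R : ℝ) * (conj lam * nu).im =
      4 * Real.pi ^ 2 * (peterssonProduct (Gamma0 N) 2 f f).re * n := by
  set c : ℂ := peterssonProduct (Gamma0 N) 2 f f with hc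
  have hc0 : c ≠ 0 := fun h0 ↦ hf0 (eq_zero_of_peterssonProduct_self_eq_zero 2 f h0)
  have hcreal : conj c = c := (peterssonProduct_conj_symm_holds (Gamma0 N) 2 f f).symm
  have hcre : (c.re : ℂ) = c := Complex.conj_eq_iff_re.mp hcreal
  have hcpos : 0 < c.re := peterssonProduct_self_pos_holds (Gamma0 N) 2 hf0
  -- periods are values of homology classes at `f`
  rw [periodLattice_eq_map_periodHomology] at hlam hnu
  obtain ⟨φ, hφ, hφf⟩ := AddSubgroup.mem_map.mp hlam
  obtain ⟨φ', hφ', hφ'f⟩ := AddSubgroup.mem_map.mp hnu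
  change φ f = lam at hφf
  change φ' f = nu at hφ'f
  subst hφf hφ'f
  -- `ψ = t^∨ φ ∈ H` is the Petersson pairing with `conj κ • f`, `κ = R φ(f) / ⟨f, f⟩`
  set ψ := t.dualMap φ with hψ
  have hψH : ψ ∈ periodHomology N := ht φ hφ
  set κ : ℂ := (R : ℂ) * φ f / c with hκ
  have hψg : ∀ g, ψ g = peterssonProduct (Gamma0 N) 2 (conj κ • f) g := by
    intro g
    obtain ⟨μ, hμ, hμc⟩ := hproj g
    rw [hψ, LinearMap.dualMap_apply, hμ, map_smul, smul_eq_mul, peterssonProduct_smul_left,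
      Complex.conj_conj, hκ]
    field_simp
    linear_combination (φ f) * hμc
  obtain ⟨n, hn⟩ := hRB ψ hψH (conj κ • f) hψg φ' hφ'
  refine ⟨n, ?_⟩
  have e : φ' (conj κ • f) = ((R : ℝ) : ℂ) * (conj (φ f) * φ' f) / ((c.re : ℝ) : ℂ) := by
    rw [map_smul, smul_eq_mul, hκ, map_div₀, map_mul, map_intCast, hcreal, hcre]
    push_cast
    ring
  rw [e, Complex.div_ofReal_im, Complex.im_ofReal_mul, div_eq_iff hcpos.ne'] at hn
  linear_combination hn

end PeriodRelations

/-! ### Pasten's Lemma 5.6 in homological form, and Thm. 5.5, from the period relations -/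

namespace ModularParametrizationData

variable {W : WeierstrassCurve ℚ} {N : ℕ} [NeZero N] (D : ModularParametrizationData W N)

/-- The unit square of `ℂ` (fundamental domain of the `ℝ`-basis `(1, i)`) has Lebesgue measure `1`.
[folklore] -/
private theorem measureReal_fundamentalDomain_basisOneI :
    (volume : Measure ℂ).real (ZSpan.fundamentalDomain Complex.basisOneI) = 1 := by
  rw [measureReal_congr (ZSpan.fundamentalDomain_ae_parallelepiped Complex.basisOneI volume),
    measureReal_def, Complex.coe_basisOneI, ← Complex.coe_orthonormalBasisOneI,
    Complex.orthonormalBasisOneI.volume_parallelepiped, ENNReal.toReal_one]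

/-- `covol(ℤω₁ + ℤω₂) = |Im(ω̄₁ ω₂)|` (area of the period parallelogram). [folklore] -/
private theorem covolume_lattice_eq_abs_im (L : PeriodPair) :
    ZLattice.covolume L.lattice = |(conj L.ω₁ * L.ω₂).im| := by
  rw [ZLattice.covolume_eq_det_mul_measureReal L.lattice volume L.latticeBasis Complex.basisOneI,
    measureReal_fundamentalDomain_basisOneI, mul_one]
  have h1 : ((↑) : L.lattice → ℂ) ∘ L.latticeBasis = L.basis := by
    ext i
    fin_cases i <;> simp
  rw [h1, Module.Basis.det_apply, Matrix.det_fin_two]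
  simp only [Module.Basis.toMatrix_apply, Complex.coe_basisOneI_repr, PeriodPair.basis_zero,
    PeriodPair.basis_one, Complex.mul_im, Complex.conj_re, Complex.conj_im, Matrix.cons_val_zero,
    Matrix.cons_val_one]
  ring_nf

/-- **Pasten's Lemma 5.6 in homological form** (2024, §5.6 p. 19: "`δ_{D,M} = ν(π₀)`, the
denominator of `π₀` with respect to `𝔼^{op}`: `m π₀ ∈ 𝔼 ⇒ δ ∣ m`", [CoKa], [ARSdeg] for `X₀(N)`),
**from Riemann's period relations.** Let `D` be a datum of an elliptic `W/ℚ` at level `N` of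
minimal degree among all data with its newform `f` (so `deg φ_D = δ_{1,N}`), and let
`t ∈ End S₂(Γ₀(N))` preserve the period homology `H = H₁(X₀(N), ℤ) ⊆ S₂^∨` under transposition
(e.g. `t ∈ 𝕋`, `anemicHeckeRing.dualMap_mem_periodHomology` — an endomorphism of `J₀(N) = S₂^∨/H`)
and act on `S₂` as `R · π₀`, `R ∈ ℤ`. Then, granted the period relations `hRB` (module
docstring), `deg φ_D ∣ R`. Proof: `D` is optimal, `Λ_E = c Λ_f` (`exists_optimalDatum'`,
`latticeEq_of_modularDegree_le`); by `exists_int_mul_im_conj_mul_eq_of_periodRelations` at the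
basis `ω₁/c, ω₂/c` of `Λ_f` and Zagier's formula `4π² c² ⟨f,f⟩ = deg · covol(Λ_E)`
(`zagier_degree_formula_holds`), `R · Im(ω̄₁ω₂) = deg · covol(Λ_E) · n` with
`covol(Λ_E) = |Im(ω̄₁ω₂)| ≠ 0`, so `R = ±deg · n`.
[cite: PastenShimura2024, §5.6 p. 19 (Lemma 5.6)] [cite: ZagierCMB1985, §1 (p. 374)]
[cite: FarkasKra1992, III.1.1 (1.1.6)] -/
theorem modularDegree_dvd_of_periodRelations [W.IsElliptic]
    (hRB : ∀ ψ ∈ periodHomology N, ∀ h : CuspForm (Gamma0 N) 2,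
      (∀ g, ψ g = peterssonProduct (Gamma0 N) 2 h g) →
      ∀ φ ∈ periodHomology N, ∃ n : ℤ, (φ h).im = 4 * Real.pi ^ 2 * n)
    (hmin : ∀ (W' : WeierstrassCurve ℚ) [W'.IsElliptic] (D' : ModularParametrizationData W' N),
      D'.f = D.f → D.modularDegree ≤ D'.modularDegree)
    {t : Module.End ℂ (CuspForm (Gamma0 N) 2)}
    (ht : ∀ φ ∈ periodHomology N, t.dualMap φ ∈ periodHomology N) {R : ℤ}
    (hproj : ∀ g, ∃ μ : ℂ, t g = μ • D.f ∧
      μ * peterssonProduct (Gamma0 N) 2 D.f D.f = (R : ℂ) * peterssonProduct (Gamma0 N) 2 D.f g) :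
    (D.modularDegree : ℤ) ∣ R := by
  have hf0 : D.f ≠ 0 := D.f_ne_zero
  -- optimality: `Λ_E = c Λ_f`
  obtain ⟨W₀, hW₀, D₀, hf₀, h₀⟩ := D.exists_optimalDatum'
  haveI := hW₀
  have hopt := D.latticeEq_of_modularDegree_le D₀ hf₀ h₀ (hmin W₀ D₀ hf₀)
  obtain ⟨w₁, hw₁, hω₁⟩ := hopt _ D.L.ω₁_mem_lattice
  obtain ⟨w₂, hw₂, hω₂⟩ := hopt _ D.L.ω₂_mem_lattice
  -- the period relations for the periods `ω₁/c, ω₂/c ∈ Λ_f`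
  obtain ⟨n, hn⟩ := exists_int_mul_im_conj_mul_eq_of_periodRelations hRB hf0 ht hproj hw₁ hw₂
  -- Zagier's formula `4π² c² ⟨f, f⟩ = deg · covol(Λ_E)`
  have hZ : ((4 * Real.pi ^ 2 * (D.c : ℝ) ^ 2 : ℝ) : ℂ) * peterssonProduct (Gamma0 N) 2 D.f D.f =
      ((D.deg * ZLattice.covolume D.L.lattice : ℝ) : ℂ) := D.zagier_degree_formula_holds
  have hZre : 4 * Real.pi ^ 2 * (D.c : ℝ) ^ 2 * (peterssonProduct (Gamma0 N) 2 D.f D.f).re =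
      D.deg * ZLattice.covolume D.L.lattice := by
    have h := congrArg Complex.re hZ
    rwa [Complex.re_ofReal_mul, Complex.ofReal_re] at h
  -- `covol(Λ_E) = |s|`, `s = Im(ω̄₁ ω₂) = c² Im(w̄₁ w₂) ≠ 0`
  set s : ℝ := (conj D.L.ω₁ * D.L.ω₂).im with hs
  have hcov : ZLattice.covolume D.L.lattice = |s| := covolume_lattice_eq_abs_im D.L
  have hs0 : s ≠ 0 := by
    intro h
    have hpos := ZLattice.covolume_pos D.L.lattice volume
    rw [hcov, h, abs_zero] at hpos
    exact lt_irrefl _ hpos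
  have hsw : s = (D.c : ℝ) ^ 2 * (conj w₁ * w₂).im := by
    have e : conj D.L.ω₁ * D.L.ω₂ = (((D.c : ℝ) ^ 2 : ℝ) : ℂ) * (conj w₁ * w₂) := by
      rw [hω₁, hω₂, map_mul, map_intCast]
      push_cast
      ring
    rw [hs, e, Complex.im_ofReal_mul]
  -- `R s = deg · n · |s|`
  have key : (R : ℝ) * s = (D.deg : ℝ) * n * |s| := by
    calc (R : ℝ) * s = (D.c : ℝ) ^ 2 * ((R : ℝ) * (conj w₁ * w₂).im) := by rw [hsw]; ring
      _ = (D.c : ℝ) ^ 2 * (4 * Real.pi ^ 2 * (peterssonProduct (Gamma0 N) 2 D.f D.f).re * n) := by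
          rw [hn]
      _ = (4 * Real.pi ^ 2 * (D.c : ℝ) ^ 2 * (peterssonProduct (Gamma0 N) 2 D.f D.f).re) * n := by
          ring
      _ = (D.deg : ℝ) * n * |s| := by rw [hZre, hcov]; ring
  show ((D.deg : ℕ) : ℤ) ∣ R
  rcases lt_or_gt_of_ne hs0 with hneg | hpos
  · rw [abs_of_neg hneg] at key
    have h : (R : ℝ) = -((D.deg : ℝ) * n) := by
      have h' : ((R : ℝ) + (D.deg : ℝ) * n) * s = 0 := by linear_combination key
      have h'' := (mul_eq_zero.mp h').resolve_right hs0
      linarith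
    refine ⟨-n, ?_⟩
    have h2 : ((R : ℤ) : ℝ) = (((D.deg : ℕ) : ℤ) * -n : ℤ) := by push_cast; linarith
    exact_mod_cast h2
  · rw [abs_of_pos hpos] at key
    have h : (R : ℝ) = (D.deg : ℝ) * n := by
      have h' : ((R : ℝ) - (D.deg : ℝ) * n) * s = 0 := by linear_combination key
      have h'' := (mul_eq_zero.mp h').resolve_right hs0
      linarith
    refine ⟨n, ?_⟩
    have h2 : ((R : ℤ) : ℝ) = (((D.deg : ℕ) : ℤ) * n : ℤ) := by push_cast; linarith
    exact_mod_cast h2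

/-- **Pasten's Thm. 5.5 for the datum `D` from Riemann's period relations**: for a datum of
minimal degree, `deg φ_D ∣ ∏_{P ≠ 𝕀_{[χ₀]}} η_{[χ₀]}(P)` — the second proof of §5.6 verbatim:
`ϖ ∈ 𝕋` (`exists_varpi`) acts as `(∏ η) · π₀` (`exists_apply_eq_smul_of_forall_mem_minimalPrimes`),
preserves `H₁(X₀(N), ℤ)` (`anemicHeckeRing.dualMap_mem_periodHomology`), and Lemma 5.6
(`modularDegree_dvd_of_periodRelations`) applies. [cite: PastenShimura2024, Thm. 5.5 p. 18 and §5.6 p. 19] -/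
theorem modularDegree_dvd_prod_heckeCongruenceModulus_of_periodRelations [W.IsElliptic]
    (hRB : ∀ ψ ∈ periodHomology N, ∀ h : CuspForm (Gamma0 N) 2,
      (∀ g, ψ g = peterssonProduct (Gamma0 N) 2 h g) →
      ∀ φ ∈ periodHomology N, ∃ n : ℤ, (φ h).im = 4 * Real.pi ^ 2 * n)
    (hmin : ∀ (W' : WeierstrassCurve ℚ) [W'.IsElliptic] (D' : ModularParametrizationData W' N),
      D'.f = D.f → D.modularDegree ≤ D'.modularDegree) :
    D.modularDegree ∣
      ∏ P ∈ ((finite_minimalPrimes_anemicHeckeRing N 2).toFinset.erase (eigenIdeal D.f)),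
        heckeCongruenceModulus D.f P := by
  classical
  have hf : HasIntegralEigenvalues D.f := D.hasIntegralEigenvalues_f
  have hf0 : D.f ≠ 0 := D.f_ne_zero
  have hfnew : D.f ∈ newSubspace0 N 2 := D.isNewformOf.1.1
  obtain ⟨ϖ, hϖP, hϖχ⟩ := exists_varpi hf hf0
  have hdvd := D.modularDegree_dvd_of_periodRelations hRB hmin
    (fun φ hφ ↦ anemicHeckeRing.dualMap_mem_periodHomology ϖ hφ) (R := intEigencharacter hf hf0 ϖ)
    (fun g ↦ exists_apply_eq_smul_of_forall_mem_minimalPrimes hf hf0 hfnew hϖP g)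
  rw [hϖχ] at hdvd
  exact Int.natCast_dvd_natCast.mp hdvd

end ModularParametrizationData

/-- **`PastenShimura2024_thm_5_5` follows from Riemann's period relations for the curves `X₀(N)`**
(the integrality of the intersection pairing on `H₁(X₀(N), ℤ) ⊆ S₂(Γ₀(N))^∨` in Petersson form:
for `ψ ∈ H` with Riesz representative `h`, `⟨h, ·⟩ = ψ`, and `φ ∈ H`, `Im φ(h) ∈ 4π² ℤ`;
Farkas–Kra III.1.1 (1.1.1)–(1.1.6) with III.3.2), by Pasten's second proof of Thm. 5.5 (§5.6) with
Lemma 5.6 in homological form (`ModularParametrizationData.modularDegree_dvd_of_periodRelations`).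
This bypasses Ribet's theorem `m_E ∣ r_E` (`modularDegree_dvd_congruenceNumber`) used by
`PastenShimura2024_thm_5_5_of_modularDegree_dvd_congruenceNumber`; the period relations are the
exact remaining input. [cite: PastenShimura2024, Thm. 5.5 p. 18 (= Thm. 1.8), §5.6 p. 19]
[cite: FarkasKra1992, III.1.1 (1.1.1)–(1.1.6), III.3.2] -/
theorem PastenShimura2024_thm_5_5_of_periodRelations
    (hRB : ∀ (N : ℕ) [NeZero N], ∀ ψ ∈ periodHomology N, ∀ h : CuspForm (Gamma0 N) 2,
      (∀ g, ψ g = peterssonProduct (Gamma0 N) 2 h g) →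
      ∀ φ ∈ periodHomology N, ∃ n : ℤ, (φ h).im = 4 * Real.pi ^ 2 * n) :
    PastenShimura2024_thm_5_5 :=
  fun N _ _ _ D hmin ↦ D.modularDegree_dvd_prod_heckeCongruenceModulus_of_periodRelations (hRB N) hmin

end Literature.NumberTheory.EllipticCurves.ModularForms

end
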